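import Literature.NumberTheory.GelbartRogawski1991.LocalDoubledAnisotropicFactorisation
import Literature.NumberTheory.GelbartRogawski1991.UnitaryDualPairThetaKernelCM
import Literature.NumberTheory.Automorphic.UnitaryGroupBorelInduction
import Literature.NumberTheory.Automorphic.UnitaryGroupFormTransport
import Literature.NumberTheory.Automorphic.UnitaryGroupLevelTransport
import Literature.NumberTheory.Automorphic.UnitaryGroupRestrictedProduct
import HarnessLib

-- buildfix G11b-3 recipe (LEDGER B13-1/B13-3), as in the GelbartRogawski1991 siblings: elaborate sequentially.
set_option Elab.async false

/-!
# The Siegel parabolic of the doubled unitary group of a hermitian LINE at a finite place IS the Borel subgroup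
# of `U(Φ₂) ≅ U(1,1)`: the Cayley transport `P_Δ(F_v) ≃ₜ* B₂(F_v)`, `p ↦ T⁻¹ · p · T`, and `det_Δ p = (T⁻¹ p T)₀₀`

Topic `NumberTheory/GelbartRogawski1991`; namespace `Literature.NumberTheory.GelbartRogawski1991.UnitaryDualPair.LocalSplitting`
(that of `LocalDoubledUnitaryDatum` ∕ `LocalDoubledUnitarySiegel` ∕ `LocalDoubledAnisotropicFactorisation`).  KERNEL MATHEMATICS ONLY:
theorems, no definition, no named fact, no instance, no notation, no `sorry`.  Cell `hodgecm-mathlib` (D-0151), line LD2 (in-house payer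
road of the rank-one organ `LineThetaTypesComplementary₁`, SOFT road (π3)∕(S5)), brick **(S6a′-T) «SIEGEL = BOREL TRANSPORT»** (LD2-plan (g2)
DEALS #11, 2026-09-02; seat A-p19 (g31)); the modulus HEAD `Δ_{P_Δ}(p) = ‖det_Δ p‖` (S6a′-H) is typed over this file by LD2-p01 (g3).

SETTING: `E/F` quadratic with conjugation `c`, a finite place `v` of `F`, `S := E ⊗_F F_v = Π_{w ∣ v} E_w` (`LocalRing E v`), an invertible
`T₀ ∈ M_1(F)` (a hermitian LINE `𝕍`, Gram entry `t = T₀ 0 0`), `J^𝔻 = (t ⊕ −t) ⊗ 1` the doubled form (`gramD F 1 T₀`), the doubled group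
`H(F_v) = U(J^𝔻)(F_v) = UnitaryGroup.localPi E c (1 + 1) JD v`, its Siegel parabolic `P_Δ(F_v) = {h | IsSiegelDelta h}` (stabiliser of the
diagonal Lagrangian `Δ = {(u, u)}`; in matrices over `S`: `h₀₀ + h₀₁ = h₁₀ + h₁₁`, ★ `isSiegelDelta_iff_isSiegelReindex`), Kudla's
`det_Δ h = h₀₀ + h₀₁` (`detDelta`, rank one), and on the other side the quasi-split form `Φ₂ = antidiag(1, 1)` over `S` with its
upper-triangular Borel `B₂ = borelU (c ⊗ 1) Φ₂` (★ `UnitaryGroupBorelInduction`; CM dress `(cmBorelTriple L 2 v).P`).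

MATHEMATICS ([Kudla1994, §3]; [HarrisKudlaSweet1996, §1 (1.11)–(1.15)]): in the `(Δ, Δ⁻)`-adapted basis given by the Cayley matrix
`T = [[1, 1], [1, −1]]` (`T⁻¹ = ½ T`, `Δ = T e₀`, `Δ⁻ = T e₁`) the doubled form reads `ᵗT̄ (t ⊕ −t) T = 2t · Φ₂`, so `h ↦ T⁻¹ h T = ½ T h T`
is an isomorphism of topological groups `U(J^𝔻)(F_v) ≃ₜ* U(2t · Φ₂)(S) = U(Φ₂)(S)` (unit rescaling, ★ `unitaryGroupOfForm_smul_of_isUnit`)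
carrying the stabiliser `P_Δ` of `Δ = T e₀` onto the stabiliser of the line `e₀`, the upper-triangular Borel `B₂`; and for `p ∈ P_Δ` the
adapted matrix is `½ T M(p) T = [[M₀₀ + M₀₁, M₁₀ − M₀₁], [0, M₁₁ − M₀₁]]`, whose `(0,0)` entry is Kudla's `x(p) = det_Δ p` (rank one:
`det_Δ p_w = (M₀₀ + M₀₁)_w` at every `w ∣ v`).

CONTENTS.  §1 ring-level `2 × 2` identities (`T M T` for a Siegel `M`, `T Φ₂ T = 2 · diag(1, −1)`, `reindex (e₂ 1)` of `1 × 1` blocks, the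
rank-one reading of `IsSiegelReindex`); §2 the generic transport **`exists_siegel_continuousMulEquiv_borelU`**: for any subgroup `P ≤ H(F_v)`
with `h ∈ P ↔ IsSiegelDelta h` (the predicate form of ★ `LocalDoubledAnisotropicFactorisation` §3) there is `Φ : ↥P ≃ₜ* ↥B₂` with
`(Φ p) = [[M₀₀ + M₀₁, M₁₀ − M₀₁], [0, M₁₁ − M₀₁]]` (`M = matS p`) and `(Φ p)₀₀ _w = detDelta w p`; built from ★ `localPiEquiv`, ★
`GLn.conjEquiv T` restricted by ★ `conj_mem_unitaryGroupOfForm_iff` (★ `ContinuousMulEquiv.restrictSubgroup`), ★ `localFormD_eq`;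
§3 the CM dress **`exists_siegel_continuousMulEquiv_cmBorel`** (`F = L⁺`, `E = L`, `c = c̄`, `δ = imagUnit L`, target ★ `(cmBorelTriple L 2 v).P`
via ★ `cmLocalForm_eq_over`) — the input of the (S6a′-H) HEAD (★ `modularCharacter_continuousMulEquiv` + ★ `modularCharacter_cmBorel_torus_two`
+ ★ `deltaChar_cmBorelTriple_eq_one_of_mem_N`).
HONEST LABEL: HC_CM is proved only modulo the printed citations (2 remaining named inputs hLiu418, h413) until rung 0 closes; this file
discharges no named fact and is count-neutral.

## References
* [Kudla1994] S. S. Kudla, *Splitting metaplectic covers of dual reductive pairs*, Israel J. Math. 87 (1994) 361–401, §3 (the Siegel parabolic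
  `P_Y`, `x(p)`).
* [HarrisKudlaSweet1996] M. Harris, S. S. Kudla, W. J. Sweet, *Theta dichotomy for unitary groups*, J. Amer. Math. Soc. 9 (1996) 941–1004,
  §1 (1.9)–(1.15) (the doubled space `𝕍 ⊕ −𝕍`, `Δ`, `P_Δ`, `det_Δ`).
* [Rogawski1990] J. D. Rogawski, *Automorphic Representations of Unitary Groups in Three Variables*, Ann. of Math. Stud. 123 (1990), §1.10 p. 9
  (the Borel `B = TN` of the quasi-split unitary group).
* [PlatonovRapinchuk1994] V. Platonov, A. Rapinchuk, *Algebraic Groups and Number Theory* (1994), §2.3 (congruent forms have conjugate unitary groups).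
-/

set_option autoImplicit false

noncomputable section

open NumberField IsDedekindDomain Matrix
open scoped MatrixGroups
open Literature.NumberTheory.Automorphic Literature.NumberTheory.Automorphic.UnitaryGroup

namespace Literature.NumberTheory.GelbartRogawski1991.UnitaryDualPair.LocalSplitting

section Ring

variable {S : Type*} [CommRing S]

/-- a `2 × 2` matrix is (block) upper triangular for `id` iff its `(1,0)` entry vanishes. [folklore] -/
private theorem blockTriangular_id_iff_fin_two (N : Matrix (Fin 2) (Fin 2) S) :
    N.BlockTriangular id ↔ N 1 0 = 0 := by
  constructor
  · intro h
    exact h (by decide)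
  · intro h i j hij
    fin_cases i <;> fin_cases j <;> simp_all

/-- **`T · M · T = 2 · [[M₀₀ + M₀₁, M₁₀ − M₀₁], [0, M₁₁ − M₀₁]]`** for the Cayley matrix `T = [[1, 1], [1, −1]]` and a SIEGEL `M`
(`M₀₀ + M₀₁ = M₁₀ + M₁₁`): the `(Δ, Δ⁻)`-adapted matrix `T⁻¹ M T = ½ T M T` of a `P_Δ`-element is upper triangular with `(0,0)` entry
`M₀₀ + M₀₁` (= the `Δ`-block `A = M₁₁ + M₁₂` of ★ `AdaptedBlocks.blkA_eq_of_blkC_eq_zero`, rank one). [cite: HarrisKudlaSweet1996, §1 (1.11)] -/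
theorem cayley_mul_mul_cayley_of_siegel (M : Matrix (Fin 2) (Fin 2) S) (h : M 0 0 + M 0 1 = M 1 0 + M 1 1) :
    !![(1 : S), 1; 1, -1] * M * !![(1 : S), 1; 1, -1] =
      (2 : S) • !![M 0 0 + M 0 1, M 1 0 - M 0 1; 0, M 1 1 - M 0 1] := by
  rw [Matrix.eta_fin_two M]
  simp only [Matrix.mul_fin_two, Matrix.of_apply, Matrix.cons_val', Matrix.cons_val_zero, Matrix.cons_val_one,
    Matrix.cons_val_fin_one, Matrix.empty_val']
  ext i j
  fin_cases i <;> fin_cases j <;> simp <;> first | linear_combination h | linear_combination (-1 : S) * h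

/-- `e₂ 1 (inl 0) = 0` (the `𝕍`-coordinate of the doubled line is index `0`). [folklore] -/
private theorem e₂_one_inl : (e₂ 1) (Sum.inl 0) = 0 := rfl

/-- `e₂ 1 (inr 0) = 1` (the `−𝕍`-coordinate of the doubled line is index `1`). [folklore] -/
private theorem e₂_one_inr : (e₂ 1) (Sum.inr 0) = 1 := rfl

/-- `(e₂ 1)⁻¹ 0 = inl 0`. [folklore] -/
private theorem e₂_one_symm_zero : (e₂ 1).symm 0 = Sum.inl 0 := by decide

/-- `(e₂ 1)⁻¹ 1 = inr 0`. [folklore] -/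
private theorem e₂_one_symm_one : (e₂ 1).symm 1 = Sum.inr 0 := by decide

omit [CommRing S] in
/-- `reindex (e₂ 1) (e₂ 1)` of a block matrix with `1 × 1` blocks is the `2 × 2` matrix of the block entries. [folklore] -/
private theorem reindex_e₂_one_fromBlocks (a b c d : Matrix (Fin 1) (Fin 1) S) :
    (Matrix.reindex (e₂ 1) (e₂ 1) (Matrix.fromBlocks a b c d) : Matrix (Fin 2) (Fin 2) S) =
      !![a 0 0, b 0 0; c 0 0, d 0 0] := by
  ext i j
  fin_cases i <;> fin_cases j <;>
    simp [Matrix.reindex_apply, e₂_one_symm_zero, e₂_one_symm_one]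

/-- **rank-one reading of the Siegel condition**: for `g ∈ GL_{1+1}(S)`, `IsSiegelReindex (e₂ 1) g ↔ g₀₀ + g₀₁ = g₁₀ + g₁₁`.
[cite: HarrisKudlaSweet1996, §1 (1.11)] -/
theorem isSiegelReindex_e₂_one_iff (g : GL (Fin (1 + 1)) S) :
    DoubledUnitary.IsSiegelReindex (e₂ 1) g ↔
      (g : Matrix (Fin (1 + 1)) (Fin (1 + 1)) S) 0 0 + (g : Matrix (Fin (1 + 1)) (Fin (1 + 1)) S) 0 1 =
        (g : Matrix (Fin (1 + 1)) (Fin (1 + 1)) S) 1 0 + (g : Matrix (Fin (1 + 1)) (Fin (1 + 1)) S) 1 1 := by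
  unfold DoubledUnitary.IsSiegelReindex
  rw [← Matrix.ext_iff]
  simp only [Fin.forall_fin_one, Matrix.add_apply, Matrix.toBlocks₁₁, Matrix.toBlocks₁₂, Matrix.toBlocks₂₁,
    Matrix.toBlocks₂₂, Matrix.of_apply, Matrix.reindex_apply, Matrix.submatrix_apply, Equiv.symm_symm,
    e₂_one_inl, e₂_one_inr]

/-- `T · M · T` for the Cayley matrix `T = [[1, 1], [1, −1]]` and any `2 × 2` matrix `M` (entrywise). [folklore] -/
private theorem cayley_mul_mul_cayley (M : Matrix (Fin 2) (Fin 2) S) :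
    !![(1 : S), 1; 1, -1] * M * !![(1 : S), 1; 1, -1] =
      !![M 0 0 + M 0 1 + M 1 0 + M 1 1, M 0 0 - M 0 1 + M 1 0 - M 1 1;
         M 0 0 + M 0 1 - M 1 0 - M 1 1, M 0 0 - M 0 1 - M 1 0 + M 1 1] := by
  rw [Matrix.eta_fin_two M]
  simp only [Matrix.mul_fin_two, Matrix.of_apply, Matrix.cons_val', Matrix.cons_val_zero, Matrix.cons_val_one,
    Matrix.cons_val_fin_one, Matrix.empty_val']
  ext i j
  fin_cases i <;> fin_cases j <;> simp <;> ring

/-- `T · T = 2 · 1` for the Cayley matrix `T = [[1, 1], [1, −1]]` (so `T⁻¹ = ½ T` when `2` is invertible). [folklore] -/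
private theorem cayley_mul_cayley :
    !![(1 : S), 1; 1, -1] * !![(1 : S), 1; 1, -1] = (2 : S) • (1 : Matrix (Fin 2) (Fin 2) S) := by
  ext i j
  fin_cases i <;> fin_cases j <;> simp [Matrix.one_fin_two] <;> norm_num

/-- Mok's split form `Φ₂` over a ring is the literal `[[0, 1], [1, 0]]`. [cite: Rogawski1990, §1.10 p. 9] -/
theorem antidiagonal_two_over : (StdForm.antidiagonal 2).over S = !![(0 : S), 1; 1, 0] := by
  ext i j
  fin_cases i <;> fin_cases j <;>
    simp [StdForm.over, StdForm.antidiagonal_J_apply]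

/-- **`ᵗT · Φ₂ · T = 2 · diag(1, −1)`**: in the Cayley frame the split form `Φ₂` becomes (twice) the doubled form `1 ⊕ (−1)` — equivalently
the doubled form `t ⊕ (−t)` of a line is `2t · Φ₂` in the `(Δ, Δ⁻)`-adapted basis. [cite: HarrisKudlaSweet1996, §1 (1.11)] -/
theorem cayley_mul_antidiagonal_mul_cayley :
    !![(1 : S), 1; 1, -1] * (StdForm.antidiagonal 2).over S * !![(1 : S), 1; 1, -1] =
      (2 : S) • !![(1 : S), 0; 0, -1] := by
  rw [antidiagonal_two_over]
  ext i j
  fin_cases i <;> fin_cases j <;> simp <;> norm_num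

end Ring

section Local

variable (F : Type) [Field F] [NumberField F] (E : Type) [Field E] [NumberField E] [Algebra F E]
  [Algebra.IsQuadraticExtension F E] (c : E ≃ₐ[F] E)
  {δ : E} (hcδ : c δ = -δ) (hδ : δ ≠ 0) {d : F} (hd : δ * δ = algebraMap F E d)
  (v : HeightOneSpectrum (𝓞 F)) {T₀ : Matrix (Fin 1) (Fin 1) F} (hT₀ : T₀.IsSymm) (hT₀d : IsUnit T₀.det)
  {JD : Matrix (Fin (1 + 1)) (Fin (1 + 1)) E} (hJD : JD = (gramD F 1 T₀).map (algebraMap F E))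
  {Jt : Matrix (Fin 2) (Fin 2) (LocalRing E v)} (hJt : Jt = (StdForm.antidiagonal 2).over (LocalRing E v))

omit [NumberField F] [Algebra.IsQuadraticExtension F E] in
/-- `2` is a unit of `E ⊗_F F_v = Π_{w ∣ v} E_w` (each factor has characteristic `0`). [folklore] -/
private theorem isUnit_two_of_localRing : IsUnit (2 : LocalRing E v) :=
  isUnit_iff_exists_inv.2 ⟨fun w => (2 : w.1.adicCompletion E)⁻¹, funext fun _ => mul_inv_cancel₀ two_ne_zero⟩

omit [Algebra.IsQuadraticExtension F E] in
/-- **rank one: `det_Δ h = h₀₀ + h₀₁`** at every `w ∣ v` (`det` of the `1 × 1` `Δ`-block `h₁₁ + h₁₂`; the `w`-component of `matS h`).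
[cite: Kudla1994, §3] [cite: HarrisKudlaSweet1996, §1 (1.15)] -/
theorem detDelta_one_eq (w : PlacesOver E v) (h : UnitaryGroup.localPi E c (1 + 1) JD v) :
    detDelta F E c v 1 w h = matS F E c v 1 h 0 0 w + matS F E c v 1 h 0 1 w := by
  have hw := coe_component_eq_matS_map F E c v 1 h w
  unfold detDelta deltaBlock
  simp only [Matrix.det_fin_one, Matrix.add_apply, Matrix.toBlocks₁₁, Matrix.toBlocks₁₂, Matrix.of_apply,
    Matrix.reindex_apply, Matrix.submatrix_apply, Equiv.symm_symm, e₂_one_inl, e₂_one_inr, hw, Matrix.map_apply,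
    Pi.evalRingHom_apply]

include hcδ hδ hd hT₀ hJD in
/-- **rank one: `h ∈ P_Δ(F_v) ↔ h₀₀ + h₀₁ = h₁₀ + h₁₁`** in the matrix `matS h` over `E ⊗_F F_v` (★ `isSiegelDelta_iff_isSiegelReindex`
read through `isSiegelReindex_e₂_one_iff`). [cite: Kudla1994, §3] [cite: HarrisKudlaSweet1996, §1 (1.11)] -/
theorem isSiegelDelta_one_iff (h : UnitaryGroup.localPi E c (1 + 1) JD v) :
    IsSiegelDelta F E c hcδ hδ hd v 1 hT₀ hJD h ↔
      matS F E c v 1 h 0 0 + matS F E c v 1 h 0 1 = matS F E c v 1 h 1 0 + matS F E c v 1 h 1 1 := by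
  rw [isSiegelDelta_iff_isSiegelReindex F E c hcδ hδ hd v 1 hT₀ hJD, isSiegelReindex_e₂_one_iff]

omit [Algebra.IsQuadraticExtension F E] in
include hJD in
/-- the local form matrix of the doubled LINE is `t · diag(1, −1)` over `E ⊗_F F_v`, `t = (T₀ ⊗ 1)₀₀` (★ `localFormD_eq` at `n = 1`).
[cite: HarrisKudlaSweet1996, §1 (1.9)] -/
theorem localFormD_one_eq :
    ((adelicForm E (1 + 1) JD).map (adeleToLocal E v) : Matrix (Fin 2) (Fin 2) (LocalRing E v)) =
      gramS F E v 1 T₀ 0 0 • !![(1 : LocalRing E v), 0; 0, -1] := by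
  rw [localFormD_eq F E v 1 hJD, reindex_e₂_one_fromBlocks]
  ext i j
  fin_cases i <;> fin_cases j <;> simp

omit [Algebra.IsQuadraticExtension F E] in
include hT₀d in
/-- the Gram entry `t = (T₀ ⊗ 1)₀₀` of an invertible line is a unit of `E ⊗_F F_v`. [folklore] -/
private theorem isUnit_gramS_one : IsUnit (gramS F E v 1 T₀ 0 0) := by
  have h : IsUnit (T₀ 0 0) := by
    have h' := hT₀d
    rwa [Matrix.det_fin_one] at h'
  exact (h.map (algebraMap F (v.adicCompletion F))).map (toLocalRing E v)

include hcδ hδ hd hT₀ hT₀d hJD hJt in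
/-- **(S6a′-T) THE SIEGEL PARABOLIC OF THE DOUBLED LINE IS THE BOREL OF `U(Φ₂)`.**  For any subgroup `P ≤ H(F_v) = U(t ⊕ −t)(F_v)` with
`h ∈ P ↔ IsSiegelDelta h` there is an isomorphism of topological groups `Φ : ↥P ≃ₜ* ↥B₂`, `B₂ = borelU (c ⊗ 1) Jt` the upper-triangular Borel
of `U(Jt)(E ⊗ F_v)` for `Jt = Φ₂`, given by the Cayley transport `p ↦ T⁻¹ · M(p) · T = ½ T M(p) T` (`T = [[1, 1], [1, −1]]`,
`M(p) = matS p` the matrix of `p` over `E ⊗ F_v`), with the explicit dictionary on `P_Δ`: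
`Φ p = [[M₀₀ + M₀₁, M₁₀ − M₀₁], [0, M₁₁ − M₀₁]]`, and `(Φ p)₀₀` at `w ∣ v` is Kudla's `det_Δ p_w` (so the diagonal unit
★ `diagEntry _ _ 0 (Φ p)` is `det_Δ p`).  Route: ★ `localPiEquiv` ∘ (★ `GLn.conjEquiv T` restricted along ★ `conj_mem_unitaryGroupOfForm_iff`,
`ᵗT̄ Φ₂ T = 2 · diag(1, −1)` and `J^𝔻_v = t · diag(1, −1)`, ★ `unitaryGroupOfForm_smul_of_isUnit`) ∘ ★ `ContinuousMulEquiv.restrictSubgroup`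
on `IsSiegelDelta ↔ (T⁻¹ M T)₁₀ = 0`. [cite: Kudla1994, §3] [cite: HarrisKudlaSweet1996, §1 (1.11)] [cite: HarrisKudlaSweet1996, §1 (1.15)]
[cite: PlatonovRapinchuk1994, §2.3] -/
theorem exists_siegel_continuousMulEquiv_borelU
    (P : Subgroup (UnitaryGroup.localPi E c (1 + 1) JD v))
    (hP : ∀ h, h ∈ P ↔ IsSiegelDelta F E c hcδ hδ hd v 1 hT₀ hJD h) :
    ∃ Φ : P ≃ₜ* borelU (conjLocal E c v) Jt,
      (∀ p : P, (((Φ p : borelU (conjLocal E c v) Jt) : unitaryGroupOfForm (conjLocal E c v) Jt) :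
            GL (Fin 2) (LocalRing E v)).1 =
          !![matS F E c v 1 (p : UnitaryGroup.localPi E c (1 + 1) JD v) 0 0 +
                matS F E c v 1 (p : UnitaryGroup.localPi E c (1 + 1) JD v) 0 1,
              matS F E c v 1 (p : UnitaryGroup.localPi E c (1 + 1) JD v) 1 0 -
                matS F E c v 1 (p : UnitaryGroup.localPi E c (1 + 1) JD v) 0 1;
             0,
              matS F E c v 1 (p : UnitaryGroup.localPi E c (1 + 1) JD v) 1 1 -
                matS F E c v 1 (p : UnitaryGroup.localPi E c (1 + 1) JD v) 0 1]) ∧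
      (∀ (p : P) (w : PlacesOver E v),
        (((Φ p : borelU (conjLocal E c v) Jt) : unitaryGroupOfForm (conjLocal E c v) Jt) :
            GL (Fin 2) (LocalRing E v)).1 0 0 w =
          detDelta F E c v 1 w (p : UnitaryGroup.localPi E c (1 + 1) JD v)) := by
  letI : Invertible (2 : LocalRing E v) := (isUnit_two_of_localRing F E v).invertible
  -- the Cayley element `T = [[1, 1], [1, -1]]`, `T⁻¹ = ⅟2 • T`
  let T : GL (Fin 2) (LocalRing E v) :=
    ⟨!![(1 : LocalRing E v), 1; 1, -1], ⅟(2 : LocalRing E v) • !![(1 : LocalRing E v), 1; 1, -1],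
      by rw [Matrix.mul_smul, cayley_mul_cayley, smul_smul, invOf_mul_self, one_smul],
      by rw [Matrix.smul_mul, cayley_mul_cayley, smul_smul, invOf_mul_self, one_smul]⟩
  have hTval : (T : GL (Fin 2) (LocalRing E v)).1 = !![(1 : LocalRing E v), 1; 1, -1] := rfl
  have hTinv : (T⁻¹ : GL (Fin 2) (LocalRing E v)).1 = ⅟(2 : LocalRing E v) • !![(1 : LocalRing E v), 1; 1, -1] := rfl
  -- the form in the Cayley frame: `ᵗT̄ · Φ₂ · T = 2 • diag(1, -1)`
  have hmapT : (!![(1 : LocalRing E v), 1; 1, -1]).map (conjLocal E c v) = !![(1 : LocalRing E v), 1; 1, -1] := by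
    ext i j
    fin_cases i <;> fin_cases j <;> simp
  have hcongr : formCongr (conjLocal E c v) T Jt = (2 : LocalRing E v) • !![(1 : LocalRing E v), 0; 0, -1] := by
    have htr : (!![(1 : LocalRing E v), 1; 1, -1])ᵀ = !![(1 : LocalRing E v), 1; 1, -1] := by
      ext i j
      fin_cases i <;> fin_cases j <;> simp
    rw [formCongr, hTval, hmapT, htr, hJt, cayley_mul_antidiagonal_mul_cayley]
  -- the two unitary groups `U(J^𝔻)(F_v)` and `U(ᵗT̄ Φ₂ T)` coincide (both are `U(diag(1, -1))`)
  have hloc : UnitaryGroup.«local» E c (1 + 1) JD v =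
      unitaryGroupOfForm (conjLocal E c v) (formCongr (conjLocal E c v) T Jt) := by
    rw [hcongr, unitaryGroupOfForm_smul_of_isUnit _ (isUnit_two_of_localRing F E v), UnitaryGroup.«local»,
      localFormD_one_eq F E v hJD, unitaryGroupOfForm_smul_of_isUnit _ (isUnit_gramS_one F E v hT₀d)]
  have hmem₂ : ∀ g : GL (Fin 2) (LocalRing E v),
      g ∈ UnitaryGroup.«local» E c (1 + 1) JD v ↔ GLn.conjEquiv T g ∈ unitaryGroupOfForm (conjLocal E c v) Jt := by
    intro g
    rw [GLn.conjEquiv_apply, conj_mem_unitaryGroupOfForm_iff, hloc]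
  -- the composite isomorphism `H(F_v) ≃ₜ* U(Φ₂)(E ⊗ F_v)`, `h ↦ T · M(h) · T⁻¹`
  let e : UnitaryGroup.localPi E c (1 + 1) JD v ≃ₜ* unitaryGroupOfForm (conjLocal E c v) Jt :=
    (localPiEquiv E c (1 + 1) JD v).trans
      (ContinuousMulEquiv.restrictSubgroup (GLn.conjEquiv T) (UnitaryGroup.«local» E c (1 + 1) JD v)
        (unitaryGroupOfForm (conjLocal E c v) Jt) hmem₂)
  have he : ∀ h : UnitaryGroup.localPi E c (1 + 1) JD v,
      ((e h : unitaryGroupOfForm (conjLocal E c v) Jt) : GL (Fin 2) (LocalRing E v)).1 =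
        ⅟(2 : LocalRing E v) • (!![(1 : LocalRing E v), 1; 1, -1] * matS F E c v 1 h * !![(1 : LocalRing E v), 1; 1, -1]) := by
    intro h
    show (T * (localPiEquiv E c (1 + 1) JD v h : UnitaryGroup.«local» E c (1 + 1) JD v).1 * T⁻¹).1 = _
    rw [Units.val_mul, Units.val_mul, hTval, hTinv, Matrix.mul_smul]
  -- the matrix of `e h` for `h ∈ P_Δ`
  have hmat : ∀ h : UnitaryGroup.localPi E c (1 + 1) JD v, IsSiegelDelta F E c hcδ hδ hd v 1 hT₀ hJD h →
      ((e h : unitaryGroupOfForm (conjLocal E c v) Jt) : GL (Fin 2) (LocalRing E v)).1 =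
        !![matS F E c v 1 h 0 0 + matS F E c v 1 h 0 1, matS F E c v 1 h 1 0 - matS F E c v 1 h 0 1;
           0, matS F E c v 1 h 1 1 - matS F E c v 1 h 0 1] := by
    intro h hh
    rw [isSiegelDelta_one_iff F E c hcδ hδ hd v hT₀ hJD] at hh
    rw [he, cayley_mul_mul_cayley_of_siegel _ hh, smul_smul, invOf_mul_self, one_smul]
  -- `P_Δ` corresponds to the upper-triangular Borel
  have hmemP : ∀ h : UnitaryGroup.localPi E c (1 + 1) JD v, h ∈ P ↔ e h ∈ borelU (conjLocal E c v) Jt := by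
    intro h
    rw [hP, mem_borelU_iff, blockTriangular_id_iff_fin_two]
    constructor
    · intro hh
      have := hmat h hh
      simp only [this, Matrix.of_apply, Matrix.cons_val', Matrix.cons_val_zero, Matrix.cons_val_one,
        Matrix.cons_val_fin_one, Matrix.empty_val']
    · intro h10
      have h10' : (⅟(2 : LocalRing E v) •
          (!![(1 : LocalRing E v), 1; 1, -1] * matS F E c v 1 h * !![(1 : LocalRing E v), 1; 1, -1])) 1 0 = 0 := by
        rw [← he]; exact h10
      rw [cayley_mul_mul_cayley] at h10'
      simp only [Matrix.smul_apply, Matrix.of_apply, Matrix.cons_val', Matrix.cons_val_zero, Matrix.cons_val_one,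
        Matrix.cons_val_fin_one, Matrix.empty_val', smul_eq_mul] at h10'
      rw [isSiegelDelta_one_iff F E c hcδ hδ hd v hT₀ hJD]
      have h2 : (2 : LocalRing E v) * ⅟(2 : LocalRing E v) = 1 := mul_invOf_self _
      linear_combination (2 : LocalRing E v) * h10' -
        (matS F E c v 1 h 0 0 + matS F E c v 1 h 0 1 - matS F E c v 1 h 1 0 - matS F E c v 1 h 1 1) * h2
  refine ⟨ContinuousMulEquiv.restrictSubgroup e P (borelU (conjLocal E c v) Jt) hmemP, ?_, ?_⟩
  · intro p
    exact hmat p ((hP _).1 p.2)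
  · intro p w
    have := hmat p ((hP _).1 p.2)
    rw [show (((ContinuousMulEquiv.restrictSubgroup e P (borelU (conjLocal E c v) Jt) hmemP p :
        borelU (conjLocal E c v) Jt) : unitaryGroupOfForm (conjLocal E c v) Jt) : GL (Fin 2) (LocalRing E v)).1 =
        ((e p : unitaryGroupOfForm (conjLocal E c v) Jt) : GL (Fin 2) (LocalRing E v)).1 from rfl, this,
      detDelta_one_eq F E c v w]
    simp

end Local

section CM

variable (L : Type) [Field L] [NumberField L] [IsCMField L] (v : HeightOneSpectrum (𝓞 ↥(maximalRealSubfield L)))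
  {T₀ : Matrix (Fin 1) (Fin 1) ↥(maximalRealSubfield L)} (hT₀ : T₀.IsSymm) (hT₀d : IsUnit T₀.det)
  {JD : Matrix (Fin (1 + 1)) (Fin (1 + 1)) L}
  (hJD : JD = (gramD (↥(maximalRealSubfield L)) 1 T₀).map (algebraMap (↥(maximalRealSubfield L)) L))

include hT₀d in
/-- **(S6a′-T), CM DRESS: `P_Δ(L⁺_v) ≃ₜ* (cmBorelTriple L 2 v).P`.**  For a CM field `L ⊃ L⁺`, a finite place `v` of `L⁺`, an invertible
line `T₀ ∈ M_1(L⁺)` and any subgroup `P` of the doubled group `U(T₀ ⊕ −T₀)(L⁺_v)` cut out by `IsSiegelDelta` (`δ = imagUnit L`): the Cayley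
transport `Φ : ↥P ≃ₜ* ↥B₂(L⁺_v)` onto the Borel of the tree's quasi-split `U(Φ₂)(L⁺_v)` (★ `cmBorelTriple L 2 v`, ★ `cmLocalForm_eq_over`), with
`Φ p = [[M₀₀ + M₀₁, M₁₀ − M₀₁], [0, M₁₁ − M₀₁]]` and `(Φ p)₀₀ _w = det_Δ p_w` — the transport along which ★ `modularCharacter_cmBorel_torus_two`
(`δ_{B₂}(diag(d₀, c̄d₀⁻¹)) = ‖d₀‖`) and ★ `deltaChar_cmBorelTriple_eq_one_of_mem_N` give the modulus of `P_Δ` as `‖det_Δ‖` ((S6a′-H)).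
[cite: Kudla1994, §3] [cite: HarrisKudlaSweet1996, §1 (1.15)] [cite: Rogawski1990, §1.10 p. 9] -/
theorem exists_siegel_continuousMulEquiv_cmBorel
    (P : Subgroup (UnitaryGroup.localPi L (IsCMField.complexConj L) (1 + 1) JD v))
    (hP : ∀ h, h ∈ P ↔ IsSiegelDelta (↥(maximalRealSubfield L)) L (IsCMField.complexConj L) (complexConj_imagUnit L)
      (imagUnit_ne_zero L) (imagUnit_mul_self L) v 1 hT₀ hJD h) :
    ∃ Φ : P ≃ₜ* (cmBorelTriple L 2 v).P,
      (∀ p : P, (((Φ p : (cmBorelTriple L 2 v).P) :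
            unitaryGroupOfForm (conjLocal L (IsCMField.complexConj L) v) (cmLocalForm L 2 v)) :
            GL (Fin 2) (LocalRing L v)).1 =
          !![matS (↥(maximalRealSubfield L)) L (IsCMField.complexConj L) v 1
                  (p : UnitaryGroup.localPi L (IsCMField.complexConj L) (1 + 1) JD v) 0 0 +
                matS (↥(maximalRealSubfield L)) L (IsCMField.complexConj L) v 1
                  (p : UnitaryGroup.localPi L (IsCMField.complexConj L) (1 + 1) JD v) 0 1,
              matS (↥(maximalRealSubfield L)) L (IsCMField.complexConj L) v 1
                  (p : UnitaryGroup.localPi L (IsCMField.complexConj L) (1 + 1) JD v) 1 0 -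
                matS (↥(maximalRealSubfield L)) L (IsCMField.complexConj L) v 1
                  (p : UnitaryGroup.localPi L (IsCMField.complexConj L) (1 + 1) JD v) 0 1;
             0,
              matS (↥(maximalRealSubfield L)) L (IsCMField.complexConj L) v 1
                  (p : UnitaryGroup.localPi L (IsCMField.complexConj L) (1 + 1) JD v) 1 1 -
                matS (↥(maximalRealSubfield L)) L (IsCMField.complexConj L) v 1
                  (p : UnitaryGroup.localPi L (IsCMField.complexConj L) (1 + 1) JD v) 0 1]) ∧
      (∀ (p : P) (w : PlacesOver L v),
        (((Φ p : (cmBorelTriple L 2 v).P) :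
            unitaryGroupOfForm (conjLocal L (IsCMField.complexConj L) v) (cmLocalForm L 2 v)) :
            GL (Fin 2) (LocalRing L v)).1 0 0 w =
          detDelta (↥(maximalRealSubfield L)) L (IsCMField.complexConj L) v 1 w
            (p : UnitaryGroup.localPi L (IsCMField.complexConj L) (1 + 1) JD v)) :=
  exists_siegel_continuousMulEquiv_borelU (↥(maximalRealSubfield L)) L (IsCMField.complexConj L)
    (complexConj_imagUnit L) (imagUnit_ne_zero L) (imagUnit_mul_self L) v hT₀ hT₀d hJD (cmLocalForm_eq_over L 2 v) P hP

end CM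

end Literature.NumberTheory.GelbartRogawski1991.UnitaryDualPair.LocalSplitting

end
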